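import Summits.QuantumFields.QCD.Theses.EulerDescent
import Literature.MathematicalPhysics.QuantumFieldTheory.QCDGoldstoneBound

/-!
# Crux `EulerDescent.HonestHeavyAnchor` (stmt-QuantumFields-16901), line `bounded_locator`, stub
# `stub_offsetBoundedBelow` (S3', the LOWER LOCATOR): the order lemmas — the lower locator IS a massive ray

Worker file for the registered stub `stub_offsetBoundedBelow` of `Cruxes/HonestHeavyAnchor/Lines/bounded_locator.lean`
(for `N_f ∈ {2,3}` and every mass-scaling, asymptotically scaling regularisation `reg` whose couplings have the closing
intrinsic Wilson corner `mc` and which carries the heavy body above `M`, the renormalised corner offset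
`(m_crit(k) − mc(k))·Z_m(k)/a_k` is eventually bounded below).  The stub itself is open-problem grade and is NOT
proved here.  What this file certifies, sorry-free and definition-free, is the ORDER half of the two idea cards
`Ideas/massive-halfline-sweep.md` and `Ideas/heavy-ray-shadow.md`:

* `offset_ge_of_massive_ray` (L1): if eventually in `k` every degenerate bare Wilson mass `μ` on or above the heavy
  trajectory point `μ_h(k) := m_crit(k) + a_k M'/Z_m(k)` is MASSIVE at `β_k` (every pair of gauge-invariant local
  observables clusters at some lattice rate, uniformly in the torus), and eventually `mc k` is the least upper bound of
  the NON-massive degenerate bare masses at `β_k`, then eventually `−M' ≤ (m_crit(k) − mc(k))·Z_m(k)/a_k`: a supremum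
  of non-massive points lies on or below the start of a massive ray (`isLUB_le_iff`), and `mc k ≤ μ_h(k)` is the
  offset inequality after clearing `a_k, Z_m(k) > 0`;
* `massive_ray_of_eventually_lt_offset` / `massive_ray_of_corner_of_pin` (L2, NECESSITY): conversely, with the corner,
  an offset eventually `> −M'` (in particular a pinned offset `→ 0` and any `M' > 0`) puts `μ_h(k)` strictly above the
  least upper bound, so every `μ ≥ μ_h(k)` is massive;
* `offsetBoundedBelow_iff_exists_massive_ray`: hence, GIVEN the corner clause, "the offset is eventually bounded
  below" and "for some `M'` the ray above `μ_h(·; M')` is eventually massive" are EQUIVALENT — the lower locator S3'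
  is, without loss or gain, the statement that the body-carrying regularisation is UNIFORMLY MASSIVE above some RGI
  height (one onset `k₀` for all bare masses on the ray and all pairs: the quantifier upgrade of the body's per-pair
  `HasLatticeMassGap`, i.e. fixed-weak-`β_k` clustering of Wilson lattice QCD with heavy degenerate quarks, uniformly
  in the mass — OPEN; no negative bare mass below the corner is ever visited);
* `stub_offsetBoundedBelow_of_uniformlyMassiveAboveOfBody`: the corner-free physics statement "every mass-scaling,
  asymptotically scaling regularisation carrying the heavy body above `M` is uniformly massive above some RGI height"
  implies the registered stub VERBATIM (reshape glue for the lead);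
* `massive_rays_of_honestHeavyAnchor`: the crux BY NAME implies that its own witness is uniformly massive above EVERY
  positive RGI height (so the massive-ray clause is a necessary condition of the crux, not an extra debt).

Pure order bookkeeping over `QCDOS.lean` (`IsLUB`, `upperBounds`) and the positivity of `a_k`, `Z_m(k)`; standard
axioms.  The non-massive set, the massive predicate and the heavy body are written out verbatim as in the route file
(no `def`), so that the registered sub-goals are matched by name + signature.
-/

namespace Summit.QuantumFields.QCD.Theorems.HonestHeavyAnchorLowerLocator

open Filter Topology
open Literature.MathematicalPhysics.QuantumFieldTheory

variable {Nf : ℕ}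

/-! ## §1 Two generic order facts on least upper bounds in `ℝ` -/

/-- **A least upper bound lies on or below the start of any ray missing the set**: if every `μ ≥ b` is outside `s`
and `c` is a least upper bound of `s`, then `c ≤ b` (every element of `s` is `< b`, so `b` is an upper bound). [folklore] -/
theorem isLUB_le_of_forall_ge_not_mem {s : Set ℝ} {c b : ℝ} (hc : IsLUB s c) (hb : ∀ μ : ℝ, b ≤ μ → μ ∉ s) :
    c ≤ b := by
  refine (isLUB_le_iff hc).2 fun ν hν => ?_
  by_contra h
  exact hb ν (not_le.1 h).le hν

/-- **Points strictly above a least upper bound are outside the set.** [folklore] -/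
theorem not_mem_of_isLUB_lt {s : Set ℝ} {c μ : ℝ} (hc : IsLUB s c) (h : c < μ) : μ ∉ s :=
  fun hmem => (not_lt.2 (hc.1 hmem)) h

/-! ## §2 The offset inequality is the corner-below-the-ray inequality (`a_k, Z_m(k) > 0`) -/

/-- `c ≤ m_crit(k) + a_k M'/Z_m(k)` iff `−M' ≤ (m_crit(k) − c)·Z_m(k)/a_k`. [folklore] -/
theorem corner_le_ray_iff (reg : QCDRegularisation Nf) (c M' : ℝ) (k : ℕ) :
    c ≤ reg.mcrit k + reg.a k * M' / reg.Zm k ↔ -M' ≤ (reg.mcrit k - c) * reg.Zm k / reg.a k := by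
  have ha := reg.a_pos k
  have hZ := reg.Zm_pos k
  rw [le_div_iff₀ ha, ← sub_le_iff_le_add', le_div_iff₀ hZ]
  constructor <;> intro h <;> nlinarith [h]

/-- `c < m_crit(k) + a_k M'/Z_m(k)` iff `−M' < (m_crit(k) − c)·Z_m(k)/a_k`. [folklore] -/
theorem corner_lt_ray_iff (reg : QCDRegularisation Nf) (c M' : ℝ) (k : ℕ) :
    c < reg.mcrit k + reg.a k * M' / reg.Zm k ↔ -M' < (reg.mcrit k - c) * reg.Zm k / reg.a k := by
  have ha := reg.a_pos k
  have hZ := reg.Zm_pos k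
  rw [lt_div_iff₀ ha, ← sub_lt_iff_lt_add', lt_div_iff₀ hZ]
  constructor <;> intro h <;> nlinarith [h]

/-! ## §3 (L1) The lower locator from a massive ray above the heavy trajectory -/

/-- **(L1) Offset bounded below by ORDER.**  If eventually in `k` every degenerate bare Wilson mass `μ` with
`m_crit(k) + a_k M'/Z_m(k) ≤ μ` is massive at `β_k` (all pairs of gauge-invariant local lattice QCD observables cluster
exponentially in Euclidean time at some lattice rate, uniformly in the torus side `2S+1`), and eventually `mc k` is
the least upper bound of the non-massive degenerate bare masses at `β_k`, then eventually
`−M' ≤ (m_crit(k) − mc(k))·Z_m(k)/a_k`.  Proof: `mc k ≤ m_crit(k) + a_k M'/Z_m(k)` by `isLUB_le_of_forall_ge_not_mem`,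
then `corner_le_ray_iff`. [folklore] -/
theorem offset_ge_of_massive_ray :
    ∀ (Nf : ℕ) (reg : QCDRegularisation Nf) (mc : ℕ → ℝ) (M' : ℝ),
      (∀ᶠ k in atTop, ∀ μ : ℝ, reg.mcrit k + reg.a k * M' / reg.Zm k ≤ μ →
        ∀ (R R' : ℕ) (A : QCDLatticeObservable Nf R) (B : QCDLatticeObservable Nf R'), ∃ (C δ : ℝ) (S₀ : ℕ),
          0 < δ ∧ ∀ S : ℕ, S₀ ≤ S → ∀ n : ℕ, n ≤ S →
            ‖qcdLatticeConnectedCorr (reg.β k) (2 * S + 1) (fun _ : Fin Nf => μ) A B n‖ ≤ C * Real.exp (-(δ * n))) →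
      (∀ᶠ k in atTop, IsLUB {μ : ℝ | ¬ (∀ (R R' : ℕ) (A : QCDLatticeObservable Nf R)
        (B : QCDLatticeObservable Nf R'), ∃ (C δ : ℝ) (S₀ : ℕ), 0 < δ ∧ ∀ S : ℕ, S₀ ≤ S → ∀ n : ℕ, n ≤ S →
          ‖qcdLatticeConnectedCorr (reg.β k) (2 * S + 1) (fun _ : Fin Nf => μ) A B n‖ ≤ C * Real.exp (-(δ * n)))}
        (mc k)) →
      ∀ᶠ k in atTop, -M' ≤ (reg.mcrit k - mc k) * reg.Zm k / reg.a k := by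
  intro Nf reg mc M' hray hcorner
  filter_upwards [hray, hcorner] with k hk hc
  have hle : mc k ≤ reg.mcrit k + reg.a k * M' / reg.Zm k :=
    isLUB_le_of_forall_ge_not_mem hc fun μ hμ hmem => hmem (hk μ hμ)
  exact (corner_le_ray_iff reg (mc k) M' k).1 hle

/-! ## §4 (L2) Necessity: with the corner, a lower offset bound puts a massive ray above the heavy trajectory -/

/-- **(L2, general form) An offset eventually `> −M'` gives a massive ray above `μ_h(·; M')`.**  If eventually
`mc k` is the least upper bound of the non-massive degenerate bare masses at `β_k` and eventually
`−M' < (m_crit(k) − mc(k))·Z_m(k)/a_k`, then eventually every `μ ≥ m_crit(k) + a_k M'/Z_m(k)` is massive at `β_k`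
(`mc k < m_crit(k) + a_k M'/Z_m(k) ≤ μ`, and points above a least upper bound are outside the set). [folklore] -/
theorem massive_ray_of_eventually_lt_offset :
    ∀ (Nf : ℕ) (reg : QCDRegularisation Nf) (mc : ℕ → ℝ) (M' : ℝ),
      (∀ᶠ k in atTop, IsLUB {μ : ℝ | ¬ (∀ (R R' : ℕ) (A : QCDLatticeObservable Nf R)
        (B : QCDLatticeObservable Nf R'), ∃ (C δ : ℝ) (S₀ : ℕ), 0 < δ ∧ ∀ S : ℕ, S₀ ≤ S → ∀ n : ℕ, n ≤ S →
          ‖qcdLatticeConnectedCorr (reg.β k) (2 * S + 1) (fun _ : Fin Nf => μ) A B n‖ ≤ C * Real.exp (-(δ * n)))}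
        (mc k)) →
      (∀ᶠ k in atTop, -M' < (reg.mcrit k - mc k) * reg.Zm k / reg.a k) →
      ∀ᶠ k in atTop, ∀ μ : ℝ, reg.mcrit k + reg.a k * M' / reg.Zm k ≤ μ →
        ∀ (R R' : ℕ) (A : QCDLatticeObservable Nf R) (B : QCDLatticeObservable Nf R'), ∃ (C δ : ℝ) (S₀ : ℕ),
          0 < δ ∧ ∀ S : ℕ, S₀ ≤ S → ∀ n : ℕ, n ≤ S →
            ‖qcdLatticeConnectedCorr (reg.β k) (2 * S + 1) (fun _ : Fin Nf => μ) A B n‖ ≤ C * Real.exp (-(δ * n)) := by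
  intro Nf reg mc M' hcorner hoff
  filter_upwards [hcorner, hoff] with k hc hk μ hμ
  have hlt : mc k < μ := lt_of_lt_of_le ((corner_lt_ray_iff reg (mc k) M' k).2 hk) hμ
  by_contra hnm
  exact not_mem_of_isLUB_lt hc hlt hnm

/-- **(L2) Corner + pin ⇒ massive ray above every positive RGI height.**  If eventually `mc k` is the least upper
bound of the non-massive degenerate bare masses at `β_k` and the offset is pinned, `(m_crit(k) − mc(k))·Z_m(k)/a_k → 0`,
then for every `M' > 0`, eventually every degenerate bare mass `μ ≥ m_crit(k) + a_k M'/Z_m(k)` is massive at `β_k`.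
So the massive-ray clause is IMPLIED by the crux's own corner-and-pin clauses: reshaping S3' to it loses nothing. [folklore] -/
theorem massive_ray_of_corner_of_pin :
    ∀ (Nf : ℕ) (reg : QCDRegularisation Nf) (mc : ℕ → ℝ) (M' : ℝ),
      (∀ᶠ k in atTop, IsLUB {μ : ℝ | ¬ (∀ (R R' : ℕ) (A : QCDLatticeObservable Nf R)
        (B : QCDLatticeObservable Nf R'), ∃ (C δ : ℝ) (S₀ : ℕ), 0 < δ ∧ ∀ S : ℕ, S₀ ≤ S → ∀ n : ℕ, n ≤ S →
          ‖qcdLatticeConnectedCorr (reg.β k) (2 * S + 1) (fun _ : Fin Nf => μ) A B n‖ ≤ C * Real.exp (-(δ * n)))}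
        (mc k)) →
      Tendsto (fun k => (reg.mcrit k - mc k) * reg.Zm k / reg.a k) atTop (𝓝 0) → 0 < M' →
      ∀ᶠ k in atTop, ∀ μ : ℝ, reg.mcrit k + reg.a k * M' / reg.Zm k ≤ μ →
        ∀ (R R' : ℕ) (A : QCDLatticeObservable Nf R) (B : QCDLatticeObservable Nf R'), ∃ (C δ : ℝ) (S₀ : ℕ),
          0 < δ ∧ ∀ S : ℕ, S₀ ≤ S → ∀ n : ℕ, n ≤ S →
            ‖qcdLatticeConnectedCorr (reg.β k) (2 * S + 1) (fun _ : Fin Nf => μ) A B n‖ ≤ C * Real.exp (-(δ * n)) := by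
  intro Nf reg mc M' hcorner hpin hM'
  exact massive_ray_of_eventually_lt_offset Nf reg mc M' hcorner (hpin.eventually_const_lt (by linarith))

/-! ## §5 The lower locator IS a massive ray (given the corner) -/

/-- **S3' ⟺ "uniformly massive above some RGI height", given the corner.**  For a regularisation whose couplings
eventually have the intrinsic corner `mc`, the offset `(m_crit − mc)·Z_m/a` is eventually bounded below iff for some
`M'` eventually every degenerate bare mass `≥ m_crit(k) + a_k M'/Z_m(k)` is massive at `β_k` (L2 with `M' := 1 − M₁`;
L1 with `M₁ := −M'`). [folklore] -/
theorem offsetBoundedBelow_iff_exists_massive_ray :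
    ∀ (Nf : ℕ) (reg : QCDRegularisation Nf) (mc : ℕ → ℝ),
      (∀ᶠ k in atTop, IsLUB {μ : ℝ | ¬ (∀ (R R' : ℕ) (A : QCDLatticeObservable Nf R)
        (B : QCDLatticeObservable Nf R'), ∃ (C δ : ℝ) (S₀ : ℕ), 0 < δ ∧ ∀ S : ℕ, S₀ ≤ S → ∀ n : ℕ, n ≤ S →
          ‖qcdLatticeConnectedCorr (reg.β k) (2 * S + 1) (fun _ : Fin Nf => μ) A B n‖ ≤ C * Real.exp (-(δ * n)))}
        (mc k)) →
      ((∃ M₁ : ℝ, ∀ᶠ k in atTop, M₁ ≤ (reg.mcrit k - mc k) * reg.Zm k / reg.a k) ↔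
        ∃ M' : ℝ, ∀ᶠ k in atTop, ∀ μ : ℝ, reg.mcrit k + reg.a k * M' / reg.Zm k ≤ μ →
          ∀ (R R' : ℕ) (A : QCDLatticeObservable Nf R) (B : QCDLatticeObservable Nf R'), ∃ (C δ : ℝ) (S₀ : ℕ),
            0 < δ ∧ ∀ S : ℕ, S₀ ≤ S → ∀ n : ℕ, n ≤ S →
              ‖qcdLatticeConnectedCorr (reg.β k) (2 * S + 1) (fun _ : Fin Nf => μ) A B n‖ ≤
                C * Real.exp (-(δ * n))) := by
  intro Nf reg mc hcorner
  constructor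
  · rintro ⟨M₁, h⟩
    exact ⟨1 - M₁, massive_ray_of_eventually_lt_offset Nf reg mc (1 - M₁) hcorner
      (h.mono fun k hk => by linarith)⟩
  · rintro ⟨M', h⟩
    exact ⟨-M', offset_ge_of_massive_ray Nf reg mc M' h hcorner⟩

/-! ## §6 Reshape glue: the corner-free physics statement implies the registered stub verbatim -/

/-- **`UniformlyMassiveAboveOfBody ⇒ stub_offsetBoundedBelow` (verbatim).**  Hypothesis (OPEN, the physics of the
lower locator in the construction's own coordinates; no corner, no negative bare mass below the corner): for
`N_f ∈ {2,3}`, every mass-scaling, asymptotically scaling regularisation carrying the heavy body above `M` is, for some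
`M'`, eventually uniformly massive on the ray of degenerate bare masses `≥ m_crit(k) + a_k M'/Z_m(k)` — one onset for all
masses on the ray and all pairs (fixed-weak-`β_k` clustering of Wilson lattice QCD with heavy degenerate quarks,
uniformly in the mass).  Conclusion: the registered statement of `stub_offsetBoundedBelow`, by L1. [folklore] -/
theorem stub_offsetBoundedBelow_of_uniformlyMassiveAboveOfBody :
    (∀ Nf : ℕ, Nf = 2 ∨ Nf = 3 → ∀ (reg : QCDRegularisation Nf) (M : ℝ), reg.HasMassScaling →
      (reg.scheme 0 0 0).HasAsymptoticScaling →
      (∀ m : Fin Nf → ℝ, (∀ f, M < m f) → ∃ (z shift : QCDField Nf → ℕ → ℝ) (T : OSData (QCDField Nf) 4),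
        IsQCDAlong (reg.scheme m z shift) T ∧ T.IsNontrivial QCDField.glue ∧ T.IsNonGaussian QCDField.glue ∧
          (∀ f g : Fin Nf, f ≠ g → T.IsNontrivial (QCDField.pseudoRe f g)) ∧
            ∃ Δ > 0, T.HasMassGap Δ ∧ (reg.scheme m z shift).HasLatticeMassGap Δ) →
      ∃ M' : ℝ, ∀ᶠ k in atTop, ∀ μ : ℝ, reg.mcrit k + reg.a k * M' / reg.Zm k ≤ μ →
        ∀ (R R' : ℕ) (A : QCDLatticeObservable Nf R) (B : QCDLatticeObservable Nf R'), ∃ (C δ : ℝ) (S₀ : ℕ),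
          0 < δ ∧ ∀ S : ℕ, S₀ ≤ S → ∀ n : ℕ, n ≤ S →
            ‖qcdLatticeConnectedCorr (reg.β k) (2 * S + 1) (fun _ : Fin Nf => μ) A B n‖ ≤ C * Real.exp (-(δ * n))) →
    ∀ Nf : ℕ, Nf = 2 ∨ Nf = 3 → ∀ (reg : QCDRegularisation Nf) (mc : ℕ → ℝ) (M : ℝ), reg.HasMassScaling →
      (reg.scheme 0 0 0).HasAsymptoticScaling →
      (∀ᶠ k in atTop, IsLUB {μ : ℝ | ¬ (∀ (R R' : ℕ) (A : QCDLatticeObservable Nf R)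
        (B : QCDLatticeObservable Nf R'), ∃ (C δ : ℝ) (S₀ : ℕ), 0 < δ ∧ ∀ S : ℕ, S₀ ≤ S → ∀ n : ℕ, n ≤ S →
          ‖qcdLatticeConnectedCorr (reg.β k) (2 * S + 1) (fun _ : Fin Nf => μ) A B n‖ ≤ C * Real.exp (-(δ * n)))} (mc k)) →
      Tendsto mc atTop (𝓝 0) →
      (∀ m : Fin Nf → ℝ, (∀ f, M < m f) → ∃ (z shift : QCDField Nf → ℕ → ℝ) (T : OSData (QCDField Nf) 4),
        IsQCDAlong (reg.scheme m z shift) T ∧ T.IsNontrivial QCDField.glue ∧ T.IsNonGaussian QCDField.glue ∧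
          (∀ f g : Fin Nf, f ≠ g → T.IsNontrivial (QCDField.pseudoRe f g)) ∧
            ∃ Δ > 0, T.HasMassGap Δ ∧ (reg.scheme m z shift).HasLatticeMassGap Δ) →
      ∃ M₁ : ℝ, ∀ᶠ k in atTop, M₁ ≤ (reg.mcrit k - mc k) * reg.Zm k / reg.a k := by
  intro h Nf hNf reg mc M hms haf hcorner _ hbody
  obtain ⟨M', hray⟩ := h Nf hNf reg M hms haf hbody
  exact ⟨-M', offset_ge_of_massive_ray Nf reg mc M' hray hcorner⟩

/-! ## §7 Necessity by name: the crux's witness is uniformly massive above every positive RGI height -/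

/-- **`HonestHeavyAnchor ⇒` massive rays of its witness.**  The crux's regularisation `reg` (with its corner `mc`) is
mass-scaling, asymptotically scaling, and — by its corner and pin clauses and L2 — for every `M' > 0` eventually
uniformly massive on the ray of degenerate bare masses `≥ m_crit(k) + a_k M'/Z_m(k)`.  Any proof of the crux therefore
proves a fixed-weak-`β_k` clustering statement, uniform in the heavy mass, along one asymptotically free sequence. [folklore] -/
theorem massive_rays_of_honestHeavyAnchor (h : Summit.QuantumFields.QCD.Theses.EulerDescent.HonestHeavyAnchor) :
    ∀ Nf : ℕ, Nf = 2 ∨ Nf = 3 → ∃ (reg : QCDRegularisation Nf) (mc : ℕ → ℝ),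
      (∀ᶠ k in atTop, IsLUB {μ : ℝ | ¬ (∀ (R R' : ℕ) (A : QCDLatticeObservable Nf R)
        (B : QCDLatticeObservable Nf R'), ∃ (C δ : ℝ) (S₀ : ℕ), 0 < δ ∧ ∀ S : ℕ, S₀ ≤ S → ∀ n : ℕ, n ≤ S →
          ‖qcdLatticeConnectedCorr (reg.β k) (2 * S + 1) (fun _ : Fin Nf => μ) A B n‖ ≤ C * Real.exp (-(δ * n)))}
        (mc k)) ∧
      reg.HasMassScaling ∧ (reg.scheme 0 0 0).HasAsymptoticScaling ∧
      ∀ M' : ℝ, 0 < M' → ∀ᶠ k in atTop, ∀ μ : ℝ, reg.mcrit k + reg.a k * M' / reg.Zm k ≤ μ →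
        ∀ (R R' : ℕ) (A : QCDLatticeObservable Nf R) (B : QCDLatticeObservable Nf R'), ∃ (C δ : ℝ) (S₀ : ℕ),
          0 < δ ∧ ∀ S : ℕ, S₀ ≤ S → ∀ n : ℕ, n ≤ S →
            ‖qcdLatticeConnectedCorr (reg.β k) (2 * S + 1) (fun _ : Fin Nf => μ) A B n‖ ≤ C * Real.exp (-(δ * n)) := by
  intro Nf hNf
  obtain ⟨reg, mc, Mh, hcorner, hpin, hms, haf, -⟩ := h Nf hNf
  exact ⟨reg, mc, hcorner, hms, haf, fun M' hM' => massive_ray_of_corner_of_pin Nf reg mc M' hcorner hpin hM'⟩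

end Summit.QuantumFields.QCD.Theorems.HonestHeavyAnchorLowerLocator
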